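import Summits.QuantumFields.YangMills.Theorems.UnitScaleTiltProp7SectET3RealityPInvJTermT3
import Summits.QuantumFields.YangMills.Theorems.UnitScaleTiltProp7SectET3RealityPInvT3
import Summits.QuantumFields.YangMills.Theorems.UnitScaleTiltProp7HWROfRowsFamily
import HarnessLib

/-!
# THE EX DISPLAY'S THREE REALITY ROWS `hHfR`, `hH₁R`, `h𝒢R` — FAMILY WRAPPERS OF THE UNCONDITIONAL MEMBER THEOREMS (no residue)

Route `UnitScaleTilt`, crux EX `MinimiserStabilityRegPr` (stmt-QuantumFields-19200), display of record S15ᴰ ✓p684527.  Its reality rows at the letters of record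
(`H₁f := H1f … (DeltaOnePJ …)`, `𝒢f := frakGfR … (DeltaOnePJ …)`, `H := H46P …`) are displayed binders `hHfR hH₁R h𝒢R` (S15ᴰ :≈150–165), although the MEMBER statements
are already unconditional theorems of the tree at every `U₀ ∈ 𝔘_k(ε₀)` in the windows `10⁹L²e ≤ 1`, `10¹²L³ε₀ ≤ 1` (`0 ≤ a`):
✓`Prop7SectET3RealityPInv.H46P_skewHermitian_traceless_at_regPr`, ✓`Prop7SectET3RealityPInvJTerm.H1f_isHermitian_traceless_at_regPr_DeltaOnePJ`,
✓`Prop7SectET3RealityPInvJTerm.frakGfR_isHermitian_traceless_at_regPr_DeltaOnePJ` ([Balaban1985BackgroundPropagators] p.393 «the operators … are real»,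
[Balaban1985Variational] (51) p.286).  This file is the FAMILY BOOKKEEPING ONLY: each row's display text VERBATIM (family-indexed over `L`, `i : Idx L`, `U₀`,
`RegPr … (α L) U₀`) from the display's own scalar rows `hα hef hWe hWε` and `ha` — so the namer can feed `hHfR := hHfR_family …`, `hH₁R := hH₁R_family …`,
`h𝒢R := h𝒢R_family …` and drop the three binders.  Nothing is estimated; the EX stub is not touched; rung R3, not Clay.  Helper toward stmt-QuantumFields-19200
(`--supports`), def-free, sorry-free.
-/

set_option autoImplicit false

noncomputable section

open scoped InnerProductSpace ComplexConjugate Matrix.Norms.L2Operator BigOperators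

namespace Summit.QuantumFields.YangMills.Theorems.Prop7RealityRowsFamily

open Literature.MathematicalPhysics.QuantumFieldTheory.Balaban1983to89
open Literature.MathematicalPhysics.QuantumFieldTheory.Balaban1983to89.T3ContinuumYM3Torus
open Literature.MathematicalPhysics.QuantumFieldTheory.Balaban1983to89.T3Thm1Carrier
open T3PrintedRegularMinimiser (RegPr)
open B9SectCLatticeCarrier (Bond)
open B11Eq115Space (NegSup NegSize Space115 JetSup levWeight)
open Summit.QuantumFields.YangMills.Theorems.Prop7SectET3Transport (periodsT3 bondEquiv)
open Summit.QuantumFields.YangMills.Theorems.Prop7SectET3CurvedPropagators (frakGfR H1f)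
open Summit.QuantumFields.YangMills.Theorems.Prop7SectET3DeltaPiPInv (H46P)
open Summit.QuantumFields.YangMills.Theorems.Prop7SectET3DeltaOnePInv (DeltaOnePJ)
open Summit.QuantumFields.YangMills.Theorems.Prop7SectET3RealityPInv (H46P_skewHermitian_traceless_at_regPr)
open Summit.QuantumFields.YangMills.Theorems.Prop7SectET3RealityPInvJTerm (H1f_isHermitian_traceless_at_regPr_DeltaOnePJ frakGfR_isHermitian_traceless_at_regPr_DeltaOnePJ)

/-- ★★ **THE FAMILY ROW `hHfR` (S15ᴰ, VERBATIM), NO RESIDUE**: print's minimizer `H(U₀) = GQ*(QGQ*)⁻¹` at the pinv letter maps skew-Hermitian traceless block data to skew-Hermitian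
traceless fields, member by member (✓`H46P_skewHermitian_traceless_at_regPr`). [cite: Balaban1985BackgroundPropagators, p.393, (3.126) p.420; Balaban1985Variational, (45)–(46) p.285, (51) p.286] -/
theorem hHfR_family
    [hFL : ∀ F : T3Family, Fact (0 < (F.L : ℝ))] [hFη : ∀ (F : T3Family) (k : ℕ), Fact (0 < ((F.L : ℝ)⁻¹) ^ k)]
    (α ef : ℕ → ℝ) (hα : ∀ L, 1 < L → 0 < α L) (hef : ∀ L, 1 < L → 0 < ef L)
    (hWe : ∀ L : ℕ, 1 < L → 10 ^ 9 * (L : ℝ) ^ 2 * ef L ≤ 1) (hWε : ∀ L : ℕ, 1 < L → 10 ^ 12 * (L : ℝ) ^ 3 * α L ≤ 1)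
    (c₀ cB : ℕ → ℝ) [hc₀ : ∀ L : ℕ, Fact (0 < c₀ L)] [hcB : ∀ L : ℕ, Fact (0 < cB L)]
    (a : ∀ L : ℕ, Idx L → ℝ) (ha : ∀ (L : ℕ) (i : Idx L), 0 < a L i) :
    ∀ (L : ℕ), 1 < L → ∀ (i : Idx L) (U₀ : GaugeField (i.1.1.P i.1.2.2) 0 (Matrix.specialUnitaryGroup (Fin 2) ℂ)), RegPr i.1.1 i.1.2.1 i.1.2.2 (α L) U₀ →
      ∀ Y, (∀ c, star (Y c) = -Y c ∧ (Y c).trace = 0) → ∀ b', star (H46P i.1.1 i.1.2.1 i.1.2.2 i.2.2.le (c₀ L) (cB L) (a L i) U₀ Y b') = -H46P i.1.1 i.1.2.1 i.1.2.2 i.2.2.le (c₀ L) (cB L) (a L i) U₀ Y b' ∧ (H46P i.1.1 i.1.2.1 i.1.2.2 i.2.2.le (c₀ L) (cB L) (a L i) U₀ Y b').trace = 0 := by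
  intro L hL i U₀ hreg Y hY b'
  have hLi : (L : ℝ) = (i.1.1.L : ℝ) := by rw [i.2.1]
  have hWe' : 10 ^ 9 * (i.1.1.L : ℝ) ^ 2 * ef L ≤ 1 := by rw [← hLi]; exact hWe L hL
  have hWε' : 10 ^ 12 * (i.1.1.L : ℝ) ^ 3 * α L ≤ 1 := by rw [← hLi]; exact hWε L hL
  exact H46P_skewHermitian_traceless_at_regPr (F := i.1.1) (n := i.1.2.1) (K := i.1.2.2) (h := i.2.2.le) (c₀ := c₀ L) (cB := cB L) (a := a L i) (U₀ := U₀)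
    (ha L i).le (hα L hL) (hef L hL) hWe' hWε' hreg Y hY b'

/-- ★★ **THE FAMILY ROW `hH₁R` (S15ᴰ, VERBATIM), NO RESIDUE**: Hermitian traceless block data `B` give Hermitian traceless `(H₁f … (DeltaOnePJ …) U₀ B)` at every bond of the member lattice,
member by member (✓`H1f_isHermitian_traceless_at_regPr_DeltaOnePJ`). [cite: Balaban1985Variational, (103) p.293, (110) p.294, (51) p.286; Balaban1985BackgroundPropagators, (3.127)–(3.129) p.421] -/
theorem hH₁R_family
    [hFL : ∀ F : T3Family, Fact (0 < (F.L : ℝ))] [hFη : ∀ (F : T3Family) (k : ℕ), Fact (0 < ((F.L : ℝ)⁻¹) ^ k)]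
    (α ef : ℕ → ℝ) (hα : ∀ L, 1 < L → 0 < α L) (hef : ∀ L, 1 < L → 0 < ef L)
    (hWe : ∀ L : ℕ, 1 < L → 10 ^ 9 * (L : ℝ) ^ 2 * ef L ≤ 1) (hWε : ∀ L : ℕ, 1 < L → 10 ^ 12 * (L : ℝ) ^ 3 * α L ≤ 1)
    (c₀ cB : ℕ → ℝ) [hc₀ : ∀ L : ℕ, Fact (0 < c₀ L)] [hcB : ∀ L : ℕ, Fact (0 < cB L)]
    (a : ∀ L : ℕ, Idx L → ℝ) (ha : ∀ (L : ℕ) (i : Idx L), 0 < a L i) :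
    ∀ (L : ℕ), 1 < L → ∀ (i : Idx L) (U₀ : GaugeField (i.1.1.P i.1.2.2) 0 (Matrix.specialUnitaryGroup (Fin 2) ℂ)), RegPr i.1.1 i.1.2.1 i.1.2.2 (α L) U₀ →
      ∀ B : PBond (i.1.1.P i.1.2.1) 0 → Matrix (Fin 2) (Fin 2) ℂ, (∀ c, (B c).IsHermitian ∧ (B c).trace = 0) →
        ∀ b' : PBond (i.1.1.P i.1.2.2) 0, (JetSup.equiv _ _ _ (H1f i.1.1 i.1.2.1 i.1.2.2 i.2.2.le (c₀ L) (cB L) (a L i) (DeltaOnePJ i.1.1 i.1.2.1 i.1.2.2 i.2.2.le (c₀ L) (cB L) (a L i)) U₀ B) (bondEquiv i.1.1 i.1.2.2 b')).IsHermitian ∧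
          (JetSup.equiv _ _ _ (H1f i.1.1 i.1.2.1 i.1.2.2 i.2.2.le (c₀ L) (cB L) (a L i) (DeltaOnePJ i.1.1 i.1.2.1 i.1.2.2 i.2.2.le (c₀ L) (cB L) (a L i)) U₀ B) (bondEquiv i.1.1 i.1.2.2 b')).trace = 0 := by
  intro L hL i U₀ hreg B hB b'
  have hLi : (L : ℝ) = (i.1.1.L : ℝ) := by rw [i.2.1]
  have hWe' : 10 ^ 9 * (i.1.1.L : ℝ) ^ 2 * ef L ≤ 1 := by rw [← hLi]; exact hWe L hL
  have hWε' : 10 ^ 12 * (i.1.1.L : ℝ) ^ 3 * α L ≤ 1 := by rw [← hLi]; exact hWε L hL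
  exact H1f_isHermitian_traceless_at_regPr_DeltaOnePJ (F := i.1.1) (n := i.1.2.1) (K := i.1.2.2) (h := i.2.2.le) (c₀ := c₀ L) (cB := cB L) (a := a L i) (U₀ := U₀)
    (ha L i).le (hα L hL) (hef L hL) hWe' hWε' hreg B hB (bondEquiv i.1.1 i.1.2.2 b')

/-- ★★ **THE FAMILY ROW `h𝒢R` (S15ᴰ, VERBATIM), NO RESIDUE**: Hermitian traceless (−3)-data `f` give Hermitian traceless (115)-fields `𝒢f … (DeltaOnePJ …) U₀ f`, member by member
(✓`frakGfR_isHermitian_traceless_at_regPr_DeltaOnePJ`). [cite: Balaban1985Variational, (110)–(111) p.294, (51) p.286; Balaban1985BackgroundPropagators, (3.128) p.421, (3.153) p.426] -/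
theorem h𝒢R_family
    [hFL : ∀ F : T3Family, Fact (0 < (F.L : ℝ))] [hFη : ∀ (F : T3Family) (k : ℕ), Fact (0 < ((F.L : ℝ)⁻¹) ^ k)]
    (α ef : ℕ → ℝ) (hα : ∀ L, 1 < L → 0 < α L) (hef : ∀ L, 1 < L → 0 < ef L)
    (hWe : ∀ L : ℕ, 1 < L → 10 ^ 9 * (L : ℝ) ^ 2 * ef L ≤ 1) (hWε : ∀ L : ℕ, 1 < L → 10 ^ 12 * (L : ℝ) ^ 3 * α L ≤ 1)
    (c₀ cB : ℕ → ℝ) [hc₀ : ∀ L : ℕ, Fact (0 < c₀ L)] [hcB : ∀ L : ℕ, Fact (0 < cB L)]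
    (a : ∀ L : ℕ, Idx L → ℝ) (ha : ∀ (L : ℕ) (i : Idx L), 0 < a L i) :
    ∀ (L : ℕ), 1 < L → ∀ (i : Idx L) (U₀ : GaugeField (i.1.1.P i.1.2.2) 0 (Matrix.specialUnitaryGroup (Fin 2) ℂ)), RegPr i.1.1 i.1.2.1 i.1.2.2 (α L) U₀ →
      ∀ f : NegSize (i.1.1.L : ℝ) (((i.1.1.L : ℝ)⁻¹) ^ (i.1.2.2 - i.1.2.1)) (fun _ : Bond 3 (periodsT3 i.1.1 i.1.2.2) => i.1.2.2 - i.1.2.1) 3 (Matrix (Fin 2) (Fin 2) ℂ),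
        (∀ b, (NegSup.equiv _ _ f b).IsHermitian ∧ (NegSup.equiv _ _ f b).trace = 0) →
        ∀ b, (JetSup.equiv _ _ _ (frakGfR i.1.1 i.1.2.1 i.1.2.2 i.2.2.le (c₀ L) (cB L) (a L i) (DeltaOnePJ i.1.1 i.1.2.1 i.1.2.2 i.2.2.le (c₀ L) (cB L) (a L i)) U₀ f) b).IsHermitian ∧ (JetSup.equiv _ _ _ (frakGfR i.1.1 i.1.2.1 i.1.2.2 i.2.2.le (c₀ L) (cB L) (a L i) (DeltaOnePJ i.1.1 i.1.2.1 i.1.2.2 i.2.2.le (c₀ L) (cB L) (a L i)) U₀ f) b).trace = 0 := by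
  intro L hL i U₀ hreg f hf b
  have hLi : (L : ℝ) = (i.1.1.L : ℝ) := by rw [i.2.1]
  have hWe' : 10 ^ 9 * (i.1.1.L : ℝ) ^ 2 * ef L ≤ 1 := by rw [← hLi]; exact hWe L hL
  have hWε' : 10 ^ 12 * (i.1.1.L : ℝ) ^ 3 * α L ≤ 1 := by rw [← hLi]; exact hWε L hL
  exact frakGfR_isHermitian_traceless_at_regPr_DeltaOnePJ (F := i.1.1) (n := i.1.2.1) (K := i.1.2.2) (h := i.2.2.le) (c₀ := c₀ L) (cB := cB L) (a := a L i) (U₀ := U₀)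
    (ha L i).le (hα L hL) (hef L hL) hWe' hWε' hreg f hf b

end Summit.QuantumFields.YangMills.Theorems.Prop7RealityRowsFamily

end
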